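import Mathlib
import Summits.NavierStokesRegularity.NavierStokesRegularity.Theorems.SubOnsagerCeilingGapFamily
import HarnessLib

/-!
# Ω-coupled four-window certificates with the TOPOLOGY AS A DATUM: face specifications
(helper file for crux stmt-NavierStokesRegularity-27057 `SubOnsagerCeiling.ForwardTailCeilingKP`, `--supports … --as helper`;
LEAD SOC g12, line «kp-shell-barrier», parametric route)

`SubOnsagerCeilingGapFamily` (p704424) made a DESIGN of the ten-face d45 topology a datum (`Params`). The LEAD g12 census (v15 §M)
locates the end of that topology at `b ≈ 1.43` (the caps-versus-cubic-floor squeeze) — the descent of the chain corner towards `b = 5/4`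
needs NEW face topologies. This file makes the topology itself a datum: a face is a `Spec` (cap `x_i ≤ c`, power floor
`x_j ≥ κ x_i³ − ε`, plane `Σ aᵢxᵢ ≤ ac` with an elimination slot, quadric floor `x₃ ≥ Q(x₀,x₁,x₂)`), a design is ANY finite family
`D : ι → Spec`; `Spec.face`, `Spec.grad` with continuity and the right-sided chain rule; the written-out forms; the region facts from
per-spec decidable side conditions (`Spec.InitOK` ⇒ `[0,1/10]⁴ ⊂ Ω`; a cap on slot 3 ⇒ `Ω ⊂ {x₃ ≤ 49/50}`; `Spec.DampOK` ⇒ the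
structural damping sign). The kernel vocabulary and the certificate bridge are the companion `SubOnsagerCeilingGapSpecKernel`.
HONEST FRAMING: MODEL-lattice plumbing (route SubOnsagerCeiling, TL-M2Break); nothing here bears on Navier–Stokes regularity; 27057 OPEN.
[cite: BarbatoMorandinRomito2011, §2 Lemma 2.1 (faces of an invariant region)]
-/

noncomputable section

-- the sub-problem namespace `NavierStokesRegularity.NavierStokesRegularity` is the tree's layout (D-0017)
set_option linter.dupNamespace false

namespace Summit.NavierStokesRegularity.NavierStokesRegularity.Theorems.VirtualFloor.GapSpec

open Summit.NavierStokesRegularity.NavierStokesRegularity.Theorems.VirtualFloor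
open Summit.NavierStokesRegularity.NavierStokesRegularity.Theorems.VirtualFloor.GapFamily (cubFaceP cubGradP cubFaceP_continuous
  cubFaceP_hasDerivWithinAt floorQ floorL capL mul_le_pos_mul)
open Summit.NavierStokesRegularity.NavierStokesRegularity.Theorems.VirtualFloor.GapFamily.Params (pos)

/-! ## Face specifications -/

/-- A face of an Ω-coupled four-window region, as data: `cap i c` = `x_i − c ≤ 0`; `cub i j κ ε` = `κ x_i³ − ε − x_j ≤ 0`
(power floor under `x_j`); `plane a0 a1 a2 a3 ac e` = `Σ aₘ xₘ − ac ≤ 0`, to be solved for the slot `e` on the active face;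
`quad c l0 l1 l2 q00 q11 q22 q01 q02 q12` = `Q(x₀,x₁,x₂) − x₃ ≤ 0` (quadric floor under `x₃`). [folklore] -/
inductive Spec
  | cap (i : Fin 4) (c : ℚ)
  | cub (i j : Fin 4) (κ ε : ℚ)
  | plane (a0 a1 a2 a3 ac : ℚ) (e : Fin 4)
  | quad (c l0 l1 l2 q00 q11 q22 q01 q02 q12 : ℚ)

namespace Spec

/-- Linear part of a plane. [folklore] -/
def planeL (a0 a1 a2 a3 : ℚ) : Fin 4 → ℝ := ![(a0 : ℝ), a1, a2, a3]

/-- The face function `g ≤ 0` of a specification. [folklore] -/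
def face : Spec → (Fin 4 → ℝ) → ℝ
  | cap i c => quadFace 0 (capL i) (-(c : ℝ))
  | cub i j κ ε => cubFaceP κ ε i j
  | plane a0 a1 a2 a3 ac _ => quadFace 0 (planeL a0 a1 a2 a3) (-(ac : ℝ))
  | quad c l0 l1 l2 q00 q11 q22 q01 q02 q12 => quadFace (floorQ q00 q11 q22 q01 q02 q12) (floorL l0 l1 l2) (c : ℝ)

/-- Its partial derivatives. [folklore] -/
def grad : Spec → Fin 4 → (Fin 4 → ℝ) → ℝ
  | cap i _ => quadFaceGrad 0 (capL i)
  | cub i j κ _ => cubGradP κ i j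
  | plane a0 a1 a2 a3 _ _ => quadFaceGrad 0 (planeL a0 a1 a2 a3)
  | quad _ l0 l1 l2 q00 q11 q22 q01 q02 q12 => quadFaceGrad (floorQ q00 q11 q22 q01 q02 q12) (floorL l0 l1 l2)

/-- Every specified face is continuous (`hcontg`). [folklore] -/
theorem face_continuous (s : Spec) : Continuous s.face := by
  cases s
  all_goals first | exact quadFace_continuous _ _ _ | exact cubFaceP_continuous _ _ _ _

/-- Right-sided chain rule of every specified face (`hchain`). [folklore] -/
theorem face_hasDerivWithinAt (s : Spec) (X : ℝ → Fin 4 → ℝ) (X' : Fin 4 → ℝ) (S : Set ℝ) (t : ℝ)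
    (hX : ∀ i, HasDerivWithinAt (fun r => X r i) (X' i) S t) :
    HasDerivWithinAt (fun r => s.face (X r)) (∑ i, s.grad i (X t) * X' i) S t := by
  cases s
  all_goals first | exact quadFace_hasDerivWithinAt _ _ _ X X' S t hX | exact cubFaceP_hasDerivWithinAt _ _ _ _ X X' S t hX

/-! ## Written-out forms -/

section forms
variable (x : Fin 4 → ℝ)

/-- A cap, written out. [folklore] -/
theorem face_cap (i : Fin 4) (c : ℚ) : (cap i c).face x = x i - c := by
  fin_cases i <;> simp [face, quadFace, capL] <;> ring
/-- A power floor, written out. [folklore] -/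
theorem face_cub (i j : Fin 4) (κ ε : ℚ) : (cub i j κ ε).face x = (κ : ℝ) * x i ^ 3 - (ε : ℝ) - x j := rfl
/-- A plane, written out. [folklore] -/
theorem face_plane (a0 a1 a2 a3 ac : ℚ) (e : Fin 4) :
    (plane a0 a1 a2 a3 ac e).face x = (a0 : ℝ) * x 0 + (a1 : ℝ) * x 1 + (a2 : ℝ) * x 2 + (a3 : ℝ) * x 3 - ac := by
  simp [face, quadFace, planeL, Fin.sum_univ_four]; ring
/-- A quadric floor, written out. [folklore] -/
theorem face_quad (c l0 l1 l2 q00 q11 q22 q01 q02 q12 : ℚ) :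
    (quad c l0 l1 l2 q00 q11 q22 q01 q02 q12).face x = (c : ℝ) + (l0 : ℝ) * x 0 + (l1 : ℝ) * x 1 + (l2 : ℝ) * x 2 +
      (q00 : ℝ) * (x 0 * x 0) + (q11 : ℝ) * (x 1 * x 1) + (q22 : ℝ) * (x 2 * x 2) + (q01 : ℝ) * (x 0 * x 1) +
      (q02 : ℝ) * (x 0 * x 2) + (q12 : ℝ) * (x 1 * x 2) - x 3 := by
  simp [face, quadFace, floorQ, floorL, Fin.sum_univ_four]; ring

/-- Gradient of a cap. [folklore] -/
theorem grad_cap (i m : Fin 4) (c : ℚ) : (cap i c).grad m x = if m = i then 1 else 0 := by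
  fin_cases i <;> fin_cases m <;> simp [grad, quadFaceGrad, capL]
/-- Gradient of a power floor. [folklore] -/
theorem grad_cub (i j m : Fin 4) (κ ε : ℚ) :
    (cub i j κ ε).grad m x = (if m = i then 3 * (κ : ℝ) * x i ^ 2 else 0) + (if m = j then -1 else 0) := rfl
/-- Gradient of a plane. [folklore] -/
theorem grad_plane (a0 a1 a2 a3 ac : ℚ) (e : Fin 4) :
    (plane a0 a1 a2 a3 ac e).grad 0 x = a0 ∧ (plane a0 a1 a2 a3 ac e).grad 1 x = a1 ∧
    (plane a0 a1 a2 a3 ac e).grad 2 x = a2 ∧ (plane a0 a1 a2 a3 ac e).grad 3 x = a3 := by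
  refine ⟨?_, ?_, ?_, ?_⟩ <;> simp [grad, quadFaceGrad, planeL]
/-- Gradient of a quadric floor. [folklore] -/
theorem grad_quad (c l0 l1 l2 q00 q11 q22 q01 q02 q12 : ℚ) :
    (quad c l0 l1 l2 q00 q11 q22 q01 q02 q12).grad 0 x = (l0 : ℝ) + 2 * (q00 : ℝ) * x 0 + (q01 : ℝ) * x 1 + (q02 : ℝ) * x 2 ∧
    (quad c l0 l1 l2 q00 q11 q22 q01 q02 q12).grad 1 x = (l1 : ℝ) + (q01 : ℝ) * x 0 + 2 * (q11 : ℝ) * x 1 + (q12 : ℝ) * x 2 ∧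
    (quad c l0 l1 l2 q00 q11 q22 q01 q02 q12).grad 2 x = (l2 : ℝ) + (q02 : ℝ) * x 0 + (q12 : ℝ) * x 1 + 2 * (q22 : ℝ) * x 2 ∧
    (quad c l0 l1 l2 q00 q11 q22 q01 q02 q12).grad 3 x = -1 := by
  refine ⟨?_, ?_, ?_, ?_⟩ <;> simp [grad, quadFaceGrad, floorQ, floorL, Fin.sum_univ_four] <;> ring

end forms

/-! ## Region facts from per-face side conditions -/

/-- Sufficient condition for `face ≤ 0` on the initial box `[0, 1/10]⁴`. [folklore] -/
def InitOK : Spec → Prop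
  | cap _ c => 1 / 10 ≤ c
  | cub _ _ κ ε => 0 ≤ κ ∧ κ / 1000 ≤ ε
  | plane a0 a1 a2 a3 ac _ => (pos a0 + pos a1 + pos a2 + pos a3) / 10 ≤ ac
  | quad c l0 l1 l2 q00 q11 q22 q01 q02 q12 =>
      c + (pos l0 + pos l1 + pos l2) / 10 + (pos q00 + pos q11 + pos q22 + pos q01 + pos q02 + pos q12) / 100 ≤ 0

/-- `face ≤ 0` on `[0, 1/10]⁴` under `InitOK`. [folklore] -/
theorem face_init (s : Spec) (hs : s.InitOK) (x : Fin 4 → ℝ) (h0 : ∀ i, 0 ≤ x i) (h1 : ∀ i, x i ≤ (1 / 10 : ℝ)) :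
    s.face x ≤ 0 := by
  have mA : ∀ {u : ℝ}, 0 ≤ u → u ≤ 1 / 10 → ∀ {w : ℝ}, 0 ≤ w → w ≤ 1 / 10 → 0 ≤ u * w ∧ u * w ≤ 1 / 100 := by
    intro u hu hu' w hw hw'
    exact ⟨mul_nonneg hu hw, by nlinarith⟩
  cases s with
  | cap i c =>
    rw [face_cap]
    have hq : (1 / 10 : ℚ) ≤ c := hs
    have hc : ((1 / 10 : ℚ) : ℝ) ≤ (c : ℝ) := Rat.cast_le.mpr hq
    norm_num at hc
    linarith [h1 i]
  | cub i j κ ε =>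
    rw [face_cub]
    obtain ⟨hk, hke⟩ := hs
    have hk' : (0 : ℝ) ≤ κ := by exact_mod_cast hk
    have hke' : (κ : ℝ) / 1000 ≤ ε := by exact_mod_cast hke
    have p0 := pow_le_pow_left₀ (h0 i) (h1 i) 3
    norm_num at p0
    linarith [mul_le_mul_of_nonneg_left p0 hk', h0 j]
  | plane a0 a1 a2 a3 ac e =>
    rw [face_plane]
    have hq : (pos a0 + pos a1 + pos a2 + pos a3) / 10 ≤ ac := hs
    have hc : ((pos a0 : ℝ) + pos a1 + pos a2 + pos a3) / 10 ≤ ac := by exact_mod_cast hq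
    have t0 := mul_le_pos_mul (q := a0) (h0 0) (h1 0); have t1 := mul_le_pos_mul (q := a1) (h0 1) (h1 1)
    have t2 := mul_le_pos_mul (q := a2) (h0 2) (h1 2); have t3 := mul_le_pos_mul (q := a3) (h0 3) (h1 3)
    linarith
  | quad c l0 l1 l2 q00 q11 q22 q01 q02 q12 =>
    rw [face_quad]
    have hc : (c : ℝ) + ((pos l0 : ℝ) + pos l1 + pos l2) / 10 +
        ((pos q00 : ℝ) + pos q11 + pos q22 + pos q01 + pos q02 + pos q12) / 100 ≤ 0 := by
      have hq : c + (pos l0 + pos l1 + pos l2) / 10 + (pos q00 + pos q11 + pos q22 + pos q01 + pos q02 + pos q12) / 100 ≤ 0 := hs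
      exact_mod_cast hq
    have a0 := h0 0; have a1 := h0 1; have a2 := h0 2; have a3 := h0 3
    have b0 := h1 0; have b1 := h1 1; have b2 := h1 2
    have t0 := mul_le_pos_mul (q := l0) a0 b0; have t1 := mul_le_pos_mul (q := l1) a1 b1
    have t2 := mul_le_pos_mul (q := l2) a2 b2
    have t00 := mul_le_pos_mul (q := q00) (mA a0 b0 a0 b0).1 (mA a0 b0 a0 b0).2
    have t11 := mul_le_pos_mul (q := q11) (mA a1 b1 a1 b1).1 (mA a1 b1 a1 b1).2
    have t22 := mul_le_pos_mul (q := q22) (mA a2 b2 a2 b2).1 (mA a2 b2 a2 b2).2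
    have t01 := mul_le_pos_mul (q := q01) (mA a0 b0 a1 b1).1 (mA a0 b0 a1 b1).2
    have t02 := mul_le_pos_mul (q := q02) (mA a0 b0 a2 b2).1 (mA a0 b0 a2 b2).2
    have t12 := mul_le_pos_mul (q := q12) (mA a1 b1 a2 b2).1 (mA a1 b1 a2 b2).2
    linarith

/-- Sufficient condition for the structural DAMPING sign on the active face (`b2 ≤ 3`): caps; planes with non-negative
coefficients; power floors between ADJACENT slots with `κ, ε ≥ 0`. Quadric floors (and other planes) need a certificate. [folklore] -/
def DampOK : Spec → Prop
  | cap _ _ => True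
  | cub i j κ ε => j.val = i.val + 1 ∧ 0 ≤ κ ∧ 0 ≤ ε
  | plane a0 a1 a2 a3 _ _ => 0 ≤ a0 ∧ 0 ≤ a1 ∧ 0 ≤ a2 ∧ 0 ≤ a3
  | quad _ _ _ _ _ _ _ _ _ _ => False

/-- The structural damping sign condition under `DampOK`. [folklore] -/
theorem face_damping (s : Spec) (hs : s.DampOK) (x : Fin 4 → ℝ) (b2 : ℝ) (h0 : ∀ i, 0 ≤ x i) (hb2 : 0 ≤ b2)
    (hb3 : b2 ≤ 3) (hk : s.face x = 0) :
    0 ≤ s.grad 0 x * x 0 + s.grad 1 x * (b2 * x 1) + s.grad 2 x * (b2 ^ 2 * x 2) + s.grad 3 x * (b2 ^ 3 * x 3) := by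
  have a0 := h0 0; have a1 := h0 1; have a2 := h0 2; have a3 := h0 3
  cases s with
  | cap i c =>
    simp only [grad_cap]
    fin_cases i <;> simp <;> positivity
  | cub i j κ ε =>
    obtain ⟨hij, hk0, he0⟩ := hs
    have hk' : (0 : ℝ) ≤ κ := by exact_mod_cast hk0
    have he' : (0 : ℝ) ≤ ε := by exact_mod_cast he0
    rw [face_cub] at hk
    simp only [grad_cub]
    fin_cases i <;> fin_cases j <;> simp at hij ⊢
    · have hx : x 1 = (κ : ℝ) * x 0 ^ 3 - ε := by simp at hk; linarith
      rw [hx]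
      have h3 : 0 ≤ (κ : ℝ) * (x 0 ^ 3 * (3 - b2)) := mul_nonneg hk' (mul_nonneg (pow_nonneg a0 3) (by linarith))
      have h4 : 0 ≤ b2 * (ε : ℝ) := mul_nonneg hb2 he'
      nlinarith [h3, h4]
    · have hx : x 2 = (κ : ℝ) * x 1 ^ 3 - ε := by simp at hk; linarith
      rw [hx]
      have h3 : 0 ≤ b2 * ((κ : ℝ) * (x 1 ^ 3 * (3 - b2))) :=
        mul_nonneg hb2 (mul_nonneg hk' (mul_nonneg (pow_nonneg a1 3) (by linarith)))
      have h4 : 0 ≤ b2 * b2 * (ε : ℝ) := mul_nonneg (mul_nonneg hb2 hb2) he'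
      nlinarith [h3, h4]
    · have hx : x 3 = (κ : ℝ) * x 2 ^ 3 - ε := by simp at hk; linarith
      rw [hx]
      have h3 : 0 ≤ b2 * b2 * ((κ : ℝ) * (x 2 ^ 3 * (3 - b2))) :=
        mul_nonneg (mul_nonneg hb2 hb2) (mul_nonneg hk' (mul_nonneg (pow_nonneg a2 3) (by linarith)))
      have h4 : 0 ≤ b2 * b2 * b2 * (ε : ℝ) := mul_nonneg (mul_nonneg (mul_nonneg hb2 hb2) hb2) he'
      nlinarith [h3, h4]
  | plane p0 p1 p2 p3 ac e =>
    obtain ⟨g0, g1, g2, g3⟩ := grad_plane x p0 p1 p2 p3 ac e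
    obtain ⟨c0, c1, c2, c3⟩ := hs
    rw [g0, g1, g2, g3]
    have : (0:ℝ) ≤ p0 := by exact_mod_cast c0
    have : (0:ℝ) ≤ p1 := by exact_mod_cast c1
    have : (0:ℝ) ≤ p2 := by exact_mod_cast c2
    have : (0:ℝ) ≤ p3 := by exact_mod_cast c3
    positivity
  | quad => exact absurd hs id

end Spec

/-! ## Designs: finite families of specifications -/

section design
variable {ι : Type*} (D : ι → Spec)

/-- `[0, 1/10]⁴ ⊂ Ω` (`hInit`, `δ₀ = 1/10`) when every face of the design satisfies `InitOK`. [folklore] -/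
theorem design_init (hD : ∀ k, (D k).InitOK) (x : Fin 4 → ℝ) (h0 : ∀ i, 0 ≤ x i) (h1 : ∀ i, x i ≤ (1 / 10 : ℝ)) :
    ∀ k, (D k).face x ≤ 0 :=
  fun k => Spec.face_init (D k) (hD k) x h0 h1

/-- `Ω ⊂ {x₃ ≤ 49/50}` (`hSafe`) when the design contains a cap on slot `3` at height `≤ 49/50`. [folklore] -/
theorem design_safe (k₀ : ι) (c : ℚ) (hk : D k₀ = .cap 3 c) (hc : c ≤ 49 / 50) (x : Fin 4 → ℝ) (_h0 : ∀ i, 0 ≤ x i)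
    (h : ∀ k, (D k).face x ≤ 0) : x 3 ≤ (49 / 50 : ℝ) := by
  have := h k₀
  rw [hk, Spec.face_cap] at this
  have hc' : (c : ℝ) ≤ 49 / 50 := (Rat.cast_le.mpr hc).trans_eq (by norm_num)
  linarith

end design

end Summit.NavierStokesRegularity.NavierStokesRegularity.Theorems.VirtualFloor.GapSpec

end
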